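import Mathlib
import Literature.NumberTheory.Automorphic.HilbertModularFormQExpansion
import Summits.Langlands.Langlands.Theorems.CapacityClassicalityHilbertIntegralOverconvergentIsCongruenceSeedLeadingExponents
import Summits.Langlands.Langlands.Theorems.CapacityClassicalityHilbertIntegralOverconvergentIsCongruenceSeedSupplyPrelim
import Summits.Langlands.Langlands.Theorems.CapacityClassicalityHilbertIntegralOverconvergentIsCongruenceStubSmulArgModular
import Summits.Langlands.Langlands.Theorems.CapacityClassicalityHilbertIntegralOverconvergentIsCongruenceStubGenericHeight
import Summits.Langlands.Langlands.Theorems.CapacityClassicalityHilbertIntegralOverconvergentIsCongruenceStubLeadPerturb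
import Summits.Langlands.Langlands.Theorems.CapacityClassicalityHilbertIntegralOverconvergentIsCongruenceHilbertClassicalityIntSupply
import Summits.Langlands.Langlands.Theorems.CapacityClassicalityHilbertIntegralOverconvergentIsCongruenceStubModularFormCoeffSupport
import Summits.Langlands.Langlands.Theorems.CapacityClassicalityHilbertIntegralOverconvergentIsCongruenceStubModularFormPeriodic
import Summits.Langlands.Langlands.Theorems.CapacityClassicalityHilbertIntegralOverconvergentIsCongruenceStubQExpansionInjective

/-!
# Named fact (ii) of the typed Hilbert crux from ONE seed form (§ U endpoint of line Sketch-ideate-r1-k1)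

Endpoint of RESHAPE 17 (§ U) of line Sketch-ideate-r1-k1 for the crux `HilbertIntegralOverconvergentIsCongruence`
(stmt-Langlands-8485); this is the content of the lead's stub `stub_supplyFromSeed`.

**Theorem `supplyFromSeed`.**  Let `F` be totally real of degree `d ≥ 2`, `𝔫₀ ≠ 0`, and let
* `s ∈ M_{w₀}(Γ₁(𝔫₀))` be a SEED FORM: `a₀(s) = 0`, `s ≢ 0` on `ℍ`, rational-integer Fourier coefficients on the cone;
* `G ∈ M_{w₀ - k}(Γ₁(𝔫₀))` be a SHIFT FORM: `G ≢ 0` on `ℍ`, Fourier coefficients `τ`-images of an `𝓞_E`-integral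
  `qG : F → E` whose `q`-series converge absolutely on the tube under every complex embedding of `E`.

Then at the level `𝔫' = 𝔫₀ · (∏_l δ_l) ⊆ 𝔫₀` the SUPPLY of the end-to-end assembly `hilbertClassicalityModuloNamedFacts`
holds with `d = [F:ℚ]`: the `d + 1` forms `gf_l(z) = s(δ_l z)` of weight `w₀` (`δ_l = M + ω_l`, `ω_0 = 0`, `ω_1, …, ω_d`
the integral basis of `𝓞 F`, `M ≫ 0`; modular by `stub_smulArg_modular`), with integer coefficients
`a_μ(gf_l) = a_{μ/δ_l}(s)` (`stub_smulArg_fourierCoeff`, hence `E`-rational/integral/convergent data by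
`hcm_intCoeff_data`), whose monomials of every degree are LINEARLY INDEPENDENT on `ℍ` — by leading exponents for a
generic height `λ` (`stub_generic_height`): the leading exponent of `gf_l` is `δ_l ν⋆` (`ν⋆` the `λ`-minimal index in
the support of `s`, `stub_lead_perturb`), so the monomial `e` leads with `(mM + ∑_{l∈e} ω_l) ν⋆`, injective in `e`
(`ssp_sym_sum_injective`), and `sle_monomials_independent` concludes — together with `G` itself.
-/

set_option linter.dupNamespace false

noncomputable section

namespace Summit.Langlands.Langlands.Theorems.HilbertIntegralOverconvergentIsCongruence

open MeasureTheory Complex NumberField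
open Literature.NumberTheory.Automorphic Literature.NumberTheory.Automorphic.HilbertModular
open scoped MatrixGroups

/-- **Named fact (ii) from one seed form** (§ U endpoint; see the module docstring): a seed form `s` of weight
`w₀` and level `Γ₁(𝔫₀)` (vanishing at `∞`, non-zero, integer coefficients) and a shift form `G` of weight `w₀ - k`
(non-zero, `𝓞_E`-integral `E`-rational tube-convergent coefficients) yield, at a level `𝔫' ⊆ 𝔫₀`, `𝔫' ≠ 0`, forms
`gf_0, …, gf_d ∈ M_{w₀}(Γ₁(𝔫'))`, `d = [F:ℚ]`, with linearly independent monomials of every degree and `𝓞_E`-integral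
`E`-rational tube-convergent coefficients, plus `G` — the supply hypothesis of `hilbertClassicalityModuloNamedFacts`.
[folklore] -/
theorem supplyFromSeed (F : Type) [Field F] [NumberField F] [NumberField.IsTotallyReal F]
    (hd : 1 < Module.finrank ℚ F) (𝔫₀ : Ideal (𝓞 F)) (h𝔫₀ : 𝔫₀ ≠ ⊥)
    (E : Type) [Field E] [NumberField E] (τ : E →+* ℂ) (k w₀ : (F →+* ℝ) → ℤ) (s G : Point F → ℂ)
    (hs : s ∈ modularForms (Bianchi.Gamma1 𝔫₀) w₀) (hs0 : fourierCoeff s 0 = 0)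
    (hsz : ∃ z ∈ halfSpace F, s z ≠ 0) (zc : F → ℤ) (hzc : ∀ ν ∈ qIndexSet F, fourierCoeff s ν = (zc ν : ℂ))
    (hG : G ∈ modularForms (Bianchi.Gamma1 𝔫₀) (w₀ - k)) (hG0 : ∃ z ∈ halfSpace F, G z ≠ 0) (qG : F → E)
    (hcG : ∀ ν ∈ qIndexSet F, fourierCoeff G ν = τ (qG ν)) (hiG : ∀ ν, IsIntegral ℤ (qG ν))
    (haG : ∀ (τ' : E →+* ℂ) (y : (F →+* ℝ) → ℝ), (∀ σ, 0 < y σ) →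
      Summable (fun ν : {ν : F | ∀ b : 𝓞 F, ∃ n : ℤ, Algebra.trace ℚ F (ν * b) = n} ↦
        ‖τ' (qG ν)‖ * Real.exp (-(2 * Real.pi * ∑ σ : F →+* ℝ, σ (ν : F) * y σ)))) :
    ∃ 𝔫' : Ideal (𝓞 F), 𝔫' ≠ ⊥ ∧ 𝔫' ≤ 𝔫₀ ∧
    ∃ (w₀' : (F →+* ℝ) → ℤ) (gf : Fin (Module.finrank ℚ F + 1) → Point F → ℂ)
      (qg : Fin (Module.finrank ℚ F + 1) → F → E) (G' : Point F → ℂ) (qG' : F → E),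
    (∀ l, gf l ∈ modularForms (Bianchi.Gamma1 𝔫') w₀') ∧ G' ∈ modularForms (Bianchi.Gamma1 𝔫') (w₀' - k) ∧
    (∃ z ∈ halfSpace F, G' z ≠ 0) ∧
    (∀ l, ∀ ν ∈ qIndexSet F, fourierCoeff (gf l) ν = τ (qg l ν)) ∧
    (∀ ν ∈ qIndexSet F, fourierCoeff G' ν = τ (qG' ν)) ∧
    (∀ l ν, IsIntegral ℤ (qg l ν)) ∧ (∀ ν, IsIntegral ℤ (qG' ν)) ∧
    (∀ l (τ' : E →+* ℂ) (y : (F →+* ℝ) → ℝ), (∀ σ, 0 < y σ) →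
      Summable (fun ν : {ν : F | ∀ b : 𝓞 F, ∃ n : ℤ, Algebra.trace ℚ F (ν * b) = n} ↦
        ‖τ' (qg l ν)‖ * Real.exp (-(2 * Real.pi * ∑ σ : F →+* ℝ, σ (ν : F) * y σ)))) ∧
    (∀ (τ' : E →+* ℂ) (y : (F →+* ℝ) → ℝ), (∀ σ, 0 < y σ) →
      Summable (fun ν : {ν : F | ∀ b : 𝓞 F, ∃ n : ℤ, Algebra.trace ℚ F (ν * b) = n} ↦
        ‖τ' (qG' ν)‖ * Real.exp (-(2 * Real.pi * ∑ σ : F →+* ℝ, σ (ν : F) * y σ)))) ∧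
    ∀ (m : ℕ) (κ : Sym (Fin (Module.finrank ℚ F + 1)) m → ℂ),
      (∀ z ∈ halfSpace F, ∑ e, κ e *
        ((e : Multiset (Fin (Module.finrank ℚ F + 1))).map (fun l ↦ gf l z)).prod = 0) → ∀ e, κ e = 0 := by
  classical
  set d : ℕ := Module.finrank ℚ F with hd_def
  -- (1) a generic height, injective on `F`
  obtain ⟨y, hy, hinj⟩ := stub_generic_height F
  let lam : F →+ ℝ :=
    { toFun := fun ν ↦ ∑ σ : F →+* ℝ, y σ * σ ν
      map_zero' := by simp
      map_add' := fun a b ↦ by simp [mul_add, Finset.sum_add_distrib] }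
  have hlam_apply : ∀ ν, lam ν = ∑ σ : F →+* ℝ, y σ * σ ν := fun ν ↦ rfl
  have hlam : Function.Injective lam := hinj
  -- (2) the seed is in the cone class
  have hs_hol : IsHolomorphicOn F s := (mem_modularForms_iff.mp hs).holomorphic
  have hs_per := stub_modularForm_periodic F 𝔫₀ w₀ s hs
  have hs_supp := stub_modularForm_coeff_support F hd 𝔫₀ h𝔫₀ w₀ s hs
  -- (3) some `q`-expansion coefficient of `s` is non-zero
  obtain ⟨ν₁, hν₁⟩ : ∃ ν₁, qExpansion s ν₁ ≠ 0 := by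
    by_contra hall
    push Not at hall
    obtain ⟨z, hz, hsz'⟩ := hsz
    refine hsz' ?_
    have h := stub_qExpansion_injective F s 0 hs_hol (differentiableOn_const 0) hs_per (fun _ _ _ ↦ rfl)
      (fun μ hμ ↦ ?_) z hz
    · simpa using h
    rw [sle_fourierCoeff_eq_zero_of_eqOn (g := (0 : Point F → ℂ)) (fun _ _ ↦ rfl) μ]
    by_cases hμc : μ ∈ qIndexSet F
    · rw [← qExpansion_of_mem hμc]
      exact hall μ
    · exact hs_supp μ hμ hμc
  -- (4) the leading exponent `νs` of `s` and the support `S`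
  obtain ⟨νs, hνs, hνsmin⟩ := ssp_exists_height_min y hy (qExpansion s)
    (fun ν h ↦ sle_mem_qIndexSet_of_qExpansion_ne_zero h) ν₁ hν₁
  have hq0 : qExpansion s 0 = 0 := by rw [qExpansion_of_mem zero_mem_qIndexSet, hs0]
  have hνs0 : νs ≠ 0 := fun h ↦ hνs (h ▸ hq0)
  have hνsc : νs ∈ qIndexSet F := sle_mem_qIndexSet_of_qExpansion_ne_zero hνs
  set S : Set F := {ν | qExpansion s ν ≠ 0} with hS_def
  have hνsS : νs ∈ S := hνs
  have hSpos : ∀ ν ∈ S, ∀ σ : F →+* ℝ, 0 < σ ν := fun ν hν ↦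
    (mem_qIndexSet_iff.mp (sle_mem_qIndexSet_of_qExpansion_ne_zero hν)).2.resolve_left
      (fun h ↦ hν (h ▸ hq0))
  have hSfin : ∀ t : ℝ, {ν : F | ν ∈ S ∧ ∑ σ : F →+* ℝ, y σ * σ ν ≤ t}.Finite := fun t ↦
    (ssp_finite_cone_sublevel y hy t).subset fun ν hν ↦
      ⟨sle_mem_qIndexSet_of_qExpansion_ne_zero hν.1, hν.2⟩
  have hSmin : ∀ ν ∈ S, ν ≠ νs → ∑ σ : F →+* ℝ, y σ * σ νs < ∑ σ : F →+* ℝ, y σ * σ ν :=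
    fun ν hν hne ↦ lt_of_le_of_ne (hνsmin ν hν) (fun h ↦ hne (hinj h).symm)
  -- (5) `ω = (0, integral basis)` indexed by `Fin (d + 1)`
  have hcard : Fintype.card (Module.Free.ChooseBasisIndex ℤ (𝓞 F)) = d :=
    (Module.finrank_eq_card_basis (integralBasis F)).symm
  let eB : Fin d ≃ Module.Free.ChooseBasisIndex ℤ (𝓞 F) := (Fintype.equivFinOfCardEq hcard).symm
  let ω : Fin (d + 1) → 𝓞 F := Fin.cons (0 : 𝓞 F) (fun i : Fin d ↦ RingOfIntegers.basis F (eB i))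
  have hω0 : ω 0 = 0 := Fin.cons_zero _ _
  have hωs : ∀ i : Fin d, ω i.succ = RingOfIntegers.basis F (eB i) := fun i ↦ Fin.cons_succ _ _ i
  -- (6) `M` from the perturbation stub, `δ_l = M + ω_l`
  obtain ⟨M₀, hM₀⟩ := stub_lead_perturb F y hy S hSpos hSfin νs hνsS hSmin
    (Finset.univ.image fun l ↦ ((ω l : 𝓞 F) : F))
  have hM := hM₀ M₀ le_rfl
  let δ : Fin (d + 1) → 𝓞 F := fun l ↦ (M₀ : 𝓞 F) + ω l
  have hδF : ∀ l, ((δ l : 𝓞 F) : F) = (M₀ : F) + ((ω l : 𝓞 F) : F) := fun l ↦ by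
    show algebraMap (𝓞 F) F ((M₀ : 𝓞 F) + ω l) = _
    rw [map_add, map_natCast]
  have hωmem : ∀ l, ((ω l : 𝓞 F) : F) ∈ Finset.univ.image (fun l ↦ ((ω l : 𝓞 F) : F)) := fun l ↦
    Finset.mem_image_of_mem _ (Finset.mem_univ l)
  have hδpos : ∀ l, ∀ σ : F →+* ℝ, 0 < σ (δ l : F) := fun l σ ↦ by
    rw [hδF]; exact (hM _ (hωmem l)).1 σ
  have hδlead : ∀ l, ∀ ν ∈ S, ν ≠ νs → lam ((δ l : F) * νs) < lam ((δ l : F) * ν) :=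
    fun l ν hν hne ↦ by rw [hlam_apply, hlam_apply, hδF]; exact (hM _ (hωmem l)).2 ν hν hne
  have hδ0 : ∀ l, (δ l : F) ≠ 0 := fun l ↦ saf_ne_zero_of_totallyPositive F _ (hδpos l)
  -- (7) the level `𝔫' = 𝔫₀ · (∏ δ_l)`
  set Δ : 𝓞 F := ∏ l, δ l with hΔ
  have hΔ0 : Δ ≠ 0 := Finset.prod_ne_zero_iff.mpr fun l _ h ↦ hδ0 l (by rw [h]; rfl)
  set 𝔫' : Ideal (𝓞 F) := 𝔫₀ * Ideal.span {Δ} with h𝔫'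
  have h𝔫'ne : 𝔫' ≠ ⊥ :=
    Ideal.mul_eq_bot.not.mpr (not_or.mpr ⟨h𝔫₀, Ideal.span_singleton_eq_bot.not.mpr hΔ0⟩)
  have h𝔫'le : 𝔫' ≤ 𝔫₀ := Ideal.mul_le_right
  have h𝔫'leδ : ∀ l, 𝔫' ≤ 𝔫₀ * Ideal.span {δ l} := fun l ↦
    Ideal.mul_mono_right (Ideal.span_singleton_le_span_singleton.mpr
      (Finset.dvd_prod_of_mem _ (Finset.mem_univ l)))
  -- (8) the forms `gf_l(z) = s(δ_l z)`
  let gf : Fin (d + 1) → Point F → ℂ := fun l z ↦ s (fun σ ↦ ((σ (δ l : F) : ℝ) : ℂ) * z σ)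
  have hgf : ∀ l, gf l ∈ modularForms (Bianchi.Gamma1 𝔫') w₀ := fun l ↦
    modularForms_mono (ssp_gamma1_mono (h𝔫'leδ l)) _
      (stub_smulArg_modular F hd 𝔫₀ h𝔫₀ w₀ s hs (δ l) (hδpos l))
  have hgf_hol : ∀ l, IsHolomorphicOn F (gf l) := fun l ↦ (mem_modularForms_iff.mp (hgf l)).holomorphic
  have hgf_per := fun l ↦ stub_modularForm_periodic F 𝔫' w₀ (gf l) (hgf l)
  have hgf_supp := fun l ↦ stub_modularForm_coeff_support F hd 𝔫' h𝔫'ne w₀ (gf l) (hgf l)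
  -- (9) Fourier coefficients of `gf_l`: integers on the cone
  have hU2 := fun l (μ : F) (hμ : ∀ a : 𝓞 F, ∃ n : ℤ, Algebra.trace ℚ F (μ * a) = n) ↦
    stub_smulArg_fourierCoeff F s hs_hol hs_per (δ l) (hδpos l) μ hμ
  let zl : Fin (d + 1) → F → ℤ := fun l μ ↦ if μ / (δ l : F) ∈ qIndexSet F then zc (μ / (δ l : F)) else 0
  have hzl : ∀ l, ∀ μ ∈ qIndexSet F, fourierCoeff (gf l) μ = (zl l μ : ℂ) := by
    intro l μ hμc
    have hμd := (mem_qIndexSet_iff.mp hμc).1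
    by_cases hdiv : ∀ a : 𝓞 F, ∃ n : ℤ, Algebra.trace ℚ F (μ / (δ l : F) * a) = n
    · have hmem : μ / (δ l : F) ∈ qIndexSet F := ssp_div_mem_qIndexSet (δ l) (hδpos l) hμc hdiv
      simp only [zl, if_pos hmem]
      rw [(hU2 l μ hμd).1 hdiv, hzc _ hmem]
    · have hnmem : μ / (δ l : F) ∉ qIndexSet F := fun h ↦ hdiv (mem_qIndexSet_iff.mp h).1
      simp only [zl, if_neg hnmem, Int.cast_zero]
      exact (hU2 l μ hμd).2 hdiv
  have hdata := fun l ↦ hcm_intCoeff_data F 𝔫' E w₀ (gf l) (hgf l) (zl l) (hzl l)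
  choose qg hqg1 hqg2 hqg3 using hdata
  -- (10) leading points `θ_l = δ_l νs`
  let θ : Fin (d + 1) → F := fun l ↦ (δ l : F) * νs
  have hθ_def : ∀ l, θ l = (δ l : F) * νs := fun l ↦ rfl
  have hθc : ∀ l, θ l ∈ qIndexSet F := fun l ↦ ssp_mul_mem_qIndexSet (δ l) (hδpos l) hνsc
  have hθdiv : ∀ l, θ l / (δ l : F) = νs := fun l ↦ by
    rw [hθ_def, mul_div_cancel_left₀ _ (hδ0 l)]
  have hlc : ∀ l, qExpansion (gf l) (θ l) ≠ 0 := by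
    intro l
    rw [qExpansion_of_mem (hθc l)]
    have hdiv : ∀ a : 𝓞 F, ∃ n : ℤ, Algebra.trace ℚ F (θ l / (δ l : F) * a) = n := by
      rw [hθdiv]; exact (mem_qIndexSet_iff.mp hνsc).1
    rw [(hU2 l (θ l) (mem_qIndexSet_iff.mp (hθc l)).1).1 hdiv, hθdiv, ← qExpansion_of_mem hνsc]
    exact hνs
  have hmin : ∀ l ν, qExpansion (gf l) ν ≠ 0 → lam (θ l) ≤ lam ν := by
    intro l ν hν
    have hνc := sle_mem_qIndexSet_of_qExpansion_ne_zero hν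
    rw [qExpansion_of_mem hνc] at hν
    have hνd := (mem_qIndexSet_iff.mp hνc).1
    by_cases hdiv : ∀ a : 𝓞 F, ∃ n : ℤ, Algebra.trace ℚ F (ν / (δ l : F) * a) = n
    · rw [(hU2 l ν hνd).1 hdiv] at hν
      have hmem : ν / (δ l : F) ∈ qIndexSet F := ssp_div_mem_qIndexSet (δ l) (hδpos l) hνc hdiv
      have hS' : ν / (δ l : F) ∈ S := by
        show qExpansion s (ν / (δ l : F)) ≠ 0
        rwa [qExpansion_of_mem hmem]
      have hνeq : (δ l : F) * (ν / (δ l : F)) = ν := by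
        rw [mul_div_assoc', mul_div_cancel_left₀ _ (hδ0 l)]
      by_cases heq : ν / (δ l : F) = νs
      · have : ν = θ l := by rw [hθ_def, ← heq, hνeq]
        rw [this]
      · have hlt := hδlead l _ hS' heq
        rw [hνeq] at hlt
        exact hlt.le
    · exact absurd ((hU2 l ν hνd).2 hdiv) hν
  -- (11) the leading points of the monomials are pairwise distinct
  have hli : LinearIndependent ℚ (fun i : Fin d ↦ ((ω i.succ : 𝓞 F) : F)) := by
    have h1 : (fun i : Fin d ↦ ((ω i.succ : 𝓞 F) : F)) = (integralBasis F) ∘ eB := by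
      funext i
      rw [Function.comp_apply, integralBasis_apply, hωs]
    rw [h1]
    exact (integralBasis F).linearIndependent.comp _ eB.injective
  have hinjω : ∀ m, Function.Injective (fun e : Sym (Fin (d + 1)) m ↦
      ((e : Multiset (Fin (d + 1))).map (fun l ↦ ((ω l : 𝓞 F) : F))).sum) :=
    fun m ↦ ssp_sym_sum_injective (fun l ↦ ((ω l : 𝓞 F) : F)) (by rw [hω0]; rfl) hli m
  have hinjθ : ∀ m, Function.Injective (fun e : Sym (Fin (d + 1)) m ↦
      ((e : Multiset (Fin (d + 1))).map θ).sum) := by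
    intro m e e' h
    apply hinjω m
    have key : ∀ e : Sym (Fin (d + 1)) m, ((e : Multiset (Fin (d + 1))).map θ).sum =
        ((m : F) * (M₀ : F) + ((e : Multiset (Fin (d + 1))).map (fun l ↦ ((ω l : 𝓞 F) : F))).sum) * νs := by
      intro e
      simp only [hθ_def, hδF]
      rw [Multiset.sum_map_mul_right, Multiset.sum_map_add, Multiset.map_const', Multiset.sum_replicate,
        Sym.card_coe, nsmul_eq_mul]
    simp only at h ⊢
    rw [key, key] at h
    exact add_left_cancel (mul_right_cancel₀ hνs0 h)
  -- (12) independence of monomials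
  have hind : ∀ (m : ℕ) (κ : Sym (Fin (d + 1)) m → ℂ),
      (∀ z ∈ halfSpace F, ∑ e, κ e * ((e : Multiset (Fin (d + 1))).map (fun l ↦ gf l z)).prod = 0) →
      ∀ e, κ e = 0 := fun m κ hrel ↦
    sle_monomials_independent gf hgf_hol hgf_per hgf_supp lam hlam θ hlc hmin m (hinjθ m) κ hrel
  -- (13) assemble
  exact ⟨𝔫', h𝔫'ne, h𝔫'le, w₀, gf, qg, G, qG, hgf, modularForms_mono (ssp_gamma1_mono h𝔫'le) _ hG, hG0,
    fun l ν hν ↦ hqg1 l τ ν hν, hcG, fun l ν ↦ hqg2 l ν, hiG, fun l τ' y' hy' ↦ hqg3 l τ' y' hy', haG, hind⟩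

end Summit.Langlands.Langlands.Theorems.HilbertIntegralOverconvergentIsCongruence

end
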